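import Summits.CriticalPhenomena.PercolationContinuityZ3.Theorems.Transplant.SiteCSHDefs
import HarnessLib

/-!
# SITE percolation: the WORLD of a configuration relative to an avoided set (definitions of the site CSH re-typing, WP0)
# (lane `prim-bschramm`, class C1a; site twin of the bond world weights `w^ω_Y e := if (∃ z ∈ e, ∃ y ∈ Y, y ↔_ω z) then 0 else w e`)

builds on p205010 (kernel theorem, internal audit signed; external expert review pending).

The world-wise unfolding of the conditioned slack hierarchy (bond: `CSHLemmaT`, `CSHHpart`, `CSHHtwBridge`, `CSHUnfold*`) works, for a
configuration `ω`, in the "world" obtained by conditioning on the cluster `C_Y(ω)` of the avoided set `Y`: a fresh percolation with the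
original weights on the vertices not killed by `C_Y(ω)`.  In SITE percolation (convention A: a closed vertex has EMPTY cluster) the killed
("dead") vertices are: the avoided set `Y` ITSELF, the clusters `C_y(ω)` (`y ∈ Y`), and their vertex boundary.  Killing `Y` itself is
necessary — a closed `y ∈ Y` is not in `C_Y(ω)` and would otherwise be resampled (the census seat's two-engine check
FROM-census-SITE-WORLD.md, 2026-08-20: with `Y` not killed the site (Htw)/(Hpart) rows FAIL at `n = 5`; with this kernel 0 violations).
* `worldDead Γ Y ω` — the dead vertices; `worldQ Γ q Y ω` — the world weights (`0` on dead vertices, `q` elsewhere);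
* elementary facts: `Y ⊆ worldDead`, `C_y ⊆ worldDead`, `worldQ ≤ q`, `worldQ < 1` when `q < 1`, `worldQ = q` off the dead set.
Definitions file (`--supports stmt-CriticalPhenomena-4575 --as helper`); no sorries.
[cite: VandenbergHaggstromKahn2005, §2.1 Lemma 2.4 (p. 10) (given `C_Y`, a fresh percolation on the rest)] [cite: KozmaNitzan2024, Conj. 4 (p. 32)]
-/

noncomputable section

namespace Summit.CriticalPhenomena.PercolationContinuityZ3.Theorems.Transplant

namespace SiteCSH

open Set Literature.Probability.Percolation
open scoped Classical

variable {V : Type*} (Γ : SimpleGraph V)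

/-- **The dead vertices of the world of `ω` relative to the avoided set `Y`** (site): `Y` itself, the site clusters of the vertices
of `Y`, and the vertices adjacent to those clusters. [cite: VandenbergHaggstromKahn2005, §2.1 Lemma 2.4 (p. 10)] -/
def worldDead (Y : Set V) (ω : Set V) : Set V :=
  {u | u ∈ Y ∨ ∃ y ∈ Y, u ∈ siteCluster Γ ω y ∨ ∃ z ∈ siteCluster Γ ω y, Γ.Adj u z}

/-- **The site world weights** `q^ω_Y`: weight `0` on the dead vertices, the original weight elsewhere.
[cite: VandenbergHaggstromKahn2005, §2.1 Lemma 2.4 (p. 10)] -/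
def worldQ (q : V → unitInterval) (Y : Set V) (ω : Set V) : V → unitInterval :=
  fun u => if u ∈ worldDead Γ Y ω then 0 else q u

variable {Γ}

/-- The avoided set is dead. [folklore] -/
theorem mem_worldDead_of_mem {Y : Set V} {ω : Set V} {y : V} (hy : y ∈ Y) : y ∈ worldDead Γ Y ω := Or.inl hy

/-- The clusters of the avoided set are dead. [folklore] -/
theorem mem_worldDead_of_mem_siteCluster {Y : Set V} {ω : Set V} {y u : V} (hy : y ∈ Y) (hu : u ∈ siteCluster Γ ω y) :
    u ∈ worldDead Γ Y ω := Or.inr ⟨y, hy, Or.inl hu⟩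

/-- The vertex boundary of the clusters of the avoided set is dead. [folklore] -/
theorem mem_worldDead_of_adj {Y : Set V} {ω : Set V} {y z u : V} (hy : y ∈ Y) (hz : z ∈ siteCluster Γ ω y) (h : Γ.Adj u z) :
    u ∈ worldDead Γ Y ω := Or.inr ⟨y, hy, Or.inr ⟨z, hz, h⟩⟩

/-- World weight of a dead vertex. [folklore] -/
theorem worldQ_of_mem (q : V → unitInterval) {Y : Set V} {ω : Set V} {u : V} (hu : u ∈ worldDead Γ Y ω) :
    worldQ Γ q Y ω u = 0 := if_pos hu

/-- World weight of a live vertex. [folklore] -/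
theorem worldQ_of_not_mem (q : V → unitInterval) {Y : Set V} {ω : Set V} {u : V} (hu : u ∉ worldDead Γ Y ω) :
    worldQ Γ q Y ω u = q u := if_neg hu

/-- World weights are dominated by the original weights. [folklore] -/
theorem worldQ_le (q : V → unitInterval) (Y : Set V) (ω : Set V) (u : V) : worldQ Γ q Y ω u ≤ q u := by
  unfold worldQ
  split_ifs
  · exact (q u).2.1
  · exact le_rfl

/-- World weights are `< 1` as soon as the original weights are. [folklore] -/
theorem worldQ_lt_one {q : V → unitInterval} (hq : ∀ u, q u < 1) (Y : Set V) (ω : Set V) (u : V) : worldQ Γ q Y ω u < 1 :=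
  (worldQ_le q Y ω u).trans_lt (hq u)

/-- With an empty avoided set nothing is dead and the world is the original model. [folklore] -/
theorem worldQ_empty (q : V → unitInterval) (ω : Set V) : worldQ Γ q ∅ ω = q := by
  funext u
  refine worldQ_of_not_mem q ?_
  rintro (h | ⟨y, hy, _⟩)
  · exact h
  · exact hy

end SiteCSH

end Summit.CriticalPhenomena.PercolationContinuityZ3.Theorems.Transplant
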